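import Summits.NavierStokesRegularity.NavierStokesRegularity.Theorems.GaldiLiouvilleGateRecordZoomAncientOscillationBump
import Summits.NavierStokesRegularity.NavierStokesRegularity.Theorems.GaldiLiouvilleGateRecordZoomAncientPersistentBump
import Summits.NavierStokesRegularity.NavierStokesRegularity.Theorems.GaldiLiouvilleGateRecordZoomAncientFaintnessFloor
import HarnessLib.Audit

/-!
# Skeleton of the crux `GaldiLiouvilleGate.RecordZoomAncient` — line `registered` (birth), reshape r8 (final form)

(crux item `stmt-NavierStokesRegularity-0894`, rank 3, route `route-NavierStokesRegularity-GaldiLiouvilleGate`;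
tree path `Cruxes/RecordZoomAncient/Lines/birth.lean`; r1 registrar `planner-skel-stmt-NavierStokesRegularity-0894-0`;
r2–r4 lead c1, r5 lead c2, r6 lead c3, r7 and **r8 by the continuation lead
`prover-line-stmt-NavierStokesRegularity-0894-c4-0`, 2026-08-17**.)

STATE AFTER r8 (everything below is IN THE TREE, namespace `…Theorems.RecordZoomAncient.Birth`). The crux `Z` is
PROVED MODULO ONE OPEN STUB, `stub_oscillationKernel`, by the landed closed composition
`recordZoomAncient_of_oscillationKernel` (p166059). History of the kernel: r1–r6 `stub_thinSlowKernel` ⟺ FCV ("no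
faint blow-up", p159288); r7 `stub_diffuseFaintKernel` = faint ∧ no persistent isolated critical bump (near-maximal
velocity centre, bounded local enstrophy AND `L⁶` mass) ⇒ False (composition p163700); r8 `stub_oscillationKernel` =
faint ∧ no persistent critical OSCILLATION bump (any centre pair of `θM̄`-oscillation within `R₀` velocity radii,
bounded local ENSTROPHY history only) ⇒ False — each strictly weaker than the previous as a statement.
r8 technology (wave 2 of this lead's stub-workers, all landed): `stub_localZoomLimitOseen` p165139 (KNSS Lemma 6.1
for velocity zooms, Oseen data of the limit exported), `stub_oscNondegenerate` p165341 (two-point ¼-Hölder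
persistence), `stub_cutoffEnstrophyPoincare` p165484 (global enstrophy of the limit via cutoff + Poincaré),
`stub_sobolevModConst` p165551 (`Ḣ¹ ∩ L^∞ ⊂ L⁶ + ℝ³`), `stub_galileanOseen` p165762 (Galilean covariance of bounded
Oseen-mild ancient fields), and the rung `recordZoomAncientAt_of_oscillationBump` p166059 (Galilean image + forward
`L⁶` propagation `oseenAncient_memLp_of_le`). r7 technology: p162337 p162715 p162658 p162442 p162991 p163700;
faintness floor p162539. Dossier: `Cruxes/RecordZoomAncient/KERNEL.md`.

RESIDUAL ENEMIES of `stub_oscillationKernel` (what it must exclude for a faint blow-up, in velocity units `ν/M̄`,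
`ν/M̄²`): (ii) every point pair of `θM̄`-oscillation at scale `R₀ν/M̄` sits in a structure whose local enstrophy
history is unbounded in velocity units (expanding `O(1)`-gradient blobs — the zoom limits exist but have infinite
Dirichlet energy); (iii)' eventually there is no such pair at all: `‖∇u(t)‖_∞ · ν/M̄(t)² → 0` along velocity records
(sub-critical gradients: a laminar, Euler-like collapse; Tao's averaged cascade is of this kind, barrier
`Literature.Barriers.NavierStokesRegularity.TaoAveragedBlowup`). STATUS: open (not in print).

ADDENDUM (lead c5, `prover-line-stmt-NavierStokesRegularity-0894-c5-0`, 2026-08-17; stubs UNCHANGED). The registered stub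
is kernel-checked EQUIVALENT to its clean, fileable form **(K) "every classical Leray–Hopf solution from a rapidly
decaying datum with no smooth extension past `T` carries a persistent critical oscillation bump"** (the hypothesis block
of `RecordZoomAncient` verbatim, conclusion = the bump datum of the r8 rung, about `u` alone):
`Theorems/…OfBlowupBump.lean` (`recordZoomAncient_of_blowupCarriesBump : (K) → Z`, p172480),
`Theorems/…BumpOfZooms.lean` (`exists_oscillationBump_of_concentratedZooms`: the non-faint case — velocity-concentrated
enstrophy zooms — yields a bump, p172827), `Theorems/…KernelIffBlowupBump.lean` (`blowupCarriesBump_of_oscillationKernel :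
S8 → (K)`, `oscillationKernel_of_blowupCarriesBump : (K) → S8`, p172951). Type-I sub-case examined (KERNEL.md §c5):
the velocity-zoom limit of a Type-I blow-up is a Morrey-bounded (`𝐈 < ∞`, Albritton–Barker 2019 Thm 1.1) bounded
ancient mild solution, non-constant for free, but NEITHER its `L⁶` slices NOR its finite sup-enstrophy is known
("(FE): Type-I ancient solutions have finite Dirichlet energy" — open, dynamical, not bookkeeping); so even
NoTypeII (stmt-0056) does not discharge the stub with known technology.

`RecordZoomAncient_of : RecordZoomAncient` is the ONLY theorem of this file concluding the crux (A12 layer invariant: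
conclusion = the crux BY NAME, no `Prop` hypotheses, the single placeholder inside the declared stub, used by name).
-/

noncomputable section

open Set MeasureTheory Filter Topology Function
open scoped ENNReal NNReal
open Literature.Analysis.FluidPDE

namespace Summit.NavierStokesRegularity.NavierStokesRegularity.Cruxes.RecordZoomAncient.Birth

set_option linter.unusedVariables false
set_option linter.dupNamespace false

/-- **R6 `stub_oscillationKernel` (XL, OPEN — the honest residual of the line after r8).** For `ν, T > 0` and a
classical solution `(u, p)` on `ℝ³ × [0, T)`, Leray–Hopf from the rapidly decaying `u 0`, with no smooth extension
past `T`, the following cannot hold together: (1) TYPE-II ENSTROPHY, (2) EVENTUALLY SLOW DOUBLING AT EVERY SCALE,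
(3) VANISHING AT THE CRITICAL SCALE, (4) FAINTNESS (verbatim from r5–r7), and (5'') NO PERSISTENT CRITICAL OSCILLATION
BUMP: there are no base times `tc n ∈ (0,T)`, point pairs `x₁ n, x₂ n` with `‖x₁ n − x₂ n‖ ≤ R₀ν/M n`, velocity levels
`M n > 0` dominating `‖u‖` on `[0, tc n] × ℝ³` with `tc n (M n)² → ∞`, `θ > 0` with
`‖u(tc n, x₁ n) − u(tc n, x₂ n)‖ ≥ θ M n`, and `D` bounding, for every `R, S > 0` eventually in `n`, the enstrophy
(`≤ D ν M n`) of `u(t)` in `B(x₁ n, Rν/M n)` for `t ∈ [0, tc n]`, `t ≥ tc n − Sν/(M n)²`. Since (4) ⇒ (1)(2)(3)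
(r5/r6) and (5'') ⇒ r7's (5), the content is "faint ⇒ a persistent critical oscillation bump": it fails exactly for
a faint blow-up in which every point pair of `θM̄`-oscillation at scale `R₀ν/M̄` sits in a structure of unbounded local
enstrophy history in velocity units (expanding `O(1)`-gradient blob) or there is eventually no such pair at all
(`‖∇u(t)‖_∞ ν/M̄(t)² → 0`: sub-critical gradients, laminar Euler-like collapse — Tao's averaged cascade, barrier
`Literature.Barriers.NavierStokesRegularity.TaoAveragedBlowup`). STATUS: open (not in print). EQUIVALENT clean form (lead
c5): (K) "every such blow-up carries a persistent critical oscillation bump" — `blowupCarriesBump_of_oscillationKernel`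
/ `oscillationKernel_of_blowupCarriesBump` (p172951); an attacker of (K) recovers (1)–(4) in the faint case from
p159288 and the non-faint case from `exists_oscillationBump_of_concentratedZooms` (p172827). -/
theorem stub_oscillationKernel :
    ∀ (ν T : ℝ), 0 < ν → 0 < T →
      ∀ (u : ℝ → EuclideanSpace ℝ (Fin 3) → EuclideanSpace ℝ (Fin 3)) (p : ℝ → EuclideanSpace ℝ (Fin 3) → ℝ),
        IsClassicalNSSolutionOn (Set.Ico 0 T) ν 0 u p → IsLerayHopfOn T ν 0 (u 0) u →
        HasRapidSpatialDecay (u 0) → ¬ HasSmoothExtensionPast ν 0 u T →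
        (∀ C : ℝ, 0 < C → ∃ t' ∈ Set.Ico 0 T, ∀ t ∈ Set.Ico t' T, ∃ s ∈ Set.Icc 0 t,
            ENNReal.ofReal (C * (ν * Real.sqrt ν) / Real.sqrt (T - t)) <
              ∫⁻ x, ENNReal.ofReal (frobeniusNormSq (fderiv ℝ (u s) x))) →
        (∀ K : ℝ, 0 < K → ∃ t' ∈ Set.Ico 0 T, ∀ t₁ ∈ Set.Ico t' T, ∀ t₂ ∈ Set.Ioo t₁ T, ∀ L : ℝ, 0 < L →
            (∀ s ∈ Set.Icc 0 t₂,
              (∫⁻ x, ENNReal.ofReal (frobeniusNormSq (fderiv ℝ (u s) x))) ≤ ENNReal.ofReal (2 * L)) →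
            (∫⁻ x, ENNReal.ofReal (frobeniusNormSq (fderiv ℝ (u t₁) x))) ≤ ENNReal.ofReal L →
            ENNReal.ofReal (2 * L) ≤ (∫⁻ x, ENNReal.ofReal (frobeniusNormSq (fderiv ℝ (u t₂) x))) →
            K * ν ^ 3 / L ^ 2 ≤ t₂ - t₁) →
        (∀ R ε : ℝ, 0 < R → 0 < ε → ∃ t' ∈ Set.Ico 0 T, ∀ t ∈ Set.Ico t' T,
            ∀ x : EuclideanSpace ℝ (Fin 3), ∀ L : ℝ, 0 < L →
            (∀ s ∈ Set.Icc 0 t,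
              (∫⁻ x, ENNReal.ofReal (frobeniusNormSq (fderiv ℝ (u s) x))) ≤ ENNReal.ofReal L) →
            3 * ν ^ 3 / L ^ 2 ≤ t →
            (∫⁻ y in Metric.ball x (R * ν ^ 2 / L), ENNReal.ofReal (frobeniusNormSq (fderiv ℝ (u t) y))) <
              ENNReal.ofReal (ε * L)) →
        (∀ θ : ℝ, 0 < θ → ∃ t' ∈ Set.Ico 0 T, ∀ t ∈ Set.Ico t' T,
            ∀ x : EuclideanSpace ℝ (Fin 3), ∀ L : ℝ, 0 < L →
            (∀ s ∈ Set.Icc 0 t,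
              (∫⁻ x, ENNReal.ofReal (frobeniusNormSq (fderiv ℝ (u s) x))) ≤ ENNReal.ofReal L) →
            ‖u t x‖ < θ * L / ν) →
        (∀ (tc : ℕ → ℝ) (x₁ x₂ : ℕ → EuclideanSpace ℝ (Fin 3)) (M : ℕ → ℝ) (θ R₀ D : ℝ),
          (∀ n, 0 < tc n ∧ tc n < T) → (∀ n, 0 < M n) →
          (∀ n, ∀ t ∈ Set.Icc 0 (tc n), ∀ x, ‖u t x‖ ≤ M n) →
          Tendsto (fun n => tc n * M n ^ 2) atTop atTop →
          0 < θ → 0 < R₀ → (∀ n, ‖x₁ n - x₂ n‖ ≤ R₀ * (ν / M n)) →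
          (∀ n, θ * M n ≤ ‖u (tc n) (x₁ n) - u (tc n) (x₂ n)‖) →
          (∀ R S : ℝ, 0 < R → 0 < S → ∀ᶠ n in atTop, ∀ t ∈ Set.Icc 0 (tc n), tc n - S * (ν / M n ^ 2) ≤ t →
            (∫⁻ y in Metric.ball (x₁ n) (R * (ν / M n)), ENNReal.ofReal (frobeniusNormSq (fderiv ℝ (u t) y))) ≤
              ENNReal.ofReal (D * (ν * M n))) →
          False) →
        False := by
  sorry

/-- **Composition (the skeleton theorem, reshape r8, final form).** The crux BY NAME: the landed closed composition
`Theorems.RecordZoomAncient.Birth.recordZoomAncient_of_oscillationKernel` (p166059) applied to the one open stub. -/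
theorem RecordZoomAncient_of : Theses.GaldiLiouvilleGate.RecordZoomAncient :=
  Theorems.RecordZoomAncient.Birth.recordZoomAncient_of_oscillationKernel stub_oscillationKernel

end Summit.NavierStokesRegularity.NavierStokesRegularity.Cruxes.RecordZoomAncient.Birth

end
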